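import Mathlib
import Summits.Ventures.PercRepro2.PMK5Deg5LitsK60A
import Summits.Ventures.PercRepro2.PMK5Deg5LitsK60B

/-!
# The table literals of `K₆`, six sliced edges, and their kernel certification, part 0 (the family `Lk6` over the six restriction bits, from parts 0A / 0B) of 0–8
(blind cell PercRepro2, mine-2 g29; the degree-5 rung, `PMK5Deg5Kernel6.lean`)

`Lk6 i a b c d e f` is the `512`-bit vector of the `i`-th of the nineteen tables of `K₆` restricted to the edges
`9 ↦ a`, `10 ↦ b`, `11 ↦ c`, `12 ↦ d`, `13 ↦ e`, `14 ↦ f` (bit `idx2 ω` = the table at `ext6 ω a b c d e f`), generated by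
mining/mine-2/code/g29/lits6.c.  **`litOK_k6 : LitOK Lk6`** (part 8) certifies all `1216` literals against the tables in
the kernel (`lit_k6_ffffff`, …, `lit_k6_tttttt`: one `decide +kernel` per restriction, the bit tree `bits9` evaluated on the
`512` nine-edge configurations of each; part 0 = the literals (statement-only), parts 1–8 = eight certifications each).
The `4096` slice certificates `CertS Lk6 j₁ … j₆` are `PMK5Deg5CertsK6*.lean`.
-/

namespace Summit.Ventures.PercRepro2

namespace Deg5

namespace Six

/-- The table literals of `K₆` as a family over the six restriction bits. -/
def Lk6 : Fin 19 → Bool → Bool → Bool → Bool → Bool → Bool → ℕ := fun i a b c d e f =>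
  match a, b, c, d, e, f with
  | false, false, false, false, false, false => Lk6_ffffff i
  | true, false, false, false, false, false => Lk6_tfffff i
  | false, true, false, false, false, false => Lk6_ftffff i
  | true, true, false, false, false, false => Lk6_ttffff i
  | false, false, true, false, false, false => Lk6_fftfff i
  | true, false, true, false, false, false => Lk6_tftfff i
  | false, true, true, false, false, false => Lk6_fttfff i
  | true, true, true, false, false, false => Lk6_tttfff i
  | false, false, false, true, false, false => Lk6_ffftff i
  | true, false, false, true, false, false => Lk6_tfftff i
  | false, true, false, true, false, false => Lk6_ftftff i
  | true, true, false, true, false, false => Lk6_ttftff i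
  | false, false, true, true, false, false => Lk6_ffttff i
  | true, false, true, true, false, false => Lk6_tfttff i
  | false, true, true, true, false, false => Lk6_ftttff i
  | true, true, true, true, false, false => Lk6_ttttff i
  | false, false, false, false, true, false => Lk6_fffftf i
  | true, false, false, false, true, false => Lk6_tffftf i
  | false, true, false, false, true, false => Lk6_ftfftf i
  | true, true, false, false, true, false => Lk6_ttfftf i
  | false, false, true, false, true, false => Lk6_fftftf i
  | true, false, true, false, true, false => Lk6_tftftf i
  | false, true, true, false, true, false => Lk6_fttftf i
  | true, true, true, false, true, false => Lk6_tttftf i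
  | false, false, false, true, true, false => Lk6_fffttf i
  | true, false, false, true, true, false => Lk6_tffttf i
  | false, true, false, true, true, false => Lk6_ftfttf i
  | true, true, false, true, true, false => Lk6_ttfttf i
  | false, false, true, true, true, false => Lk6_fftttf i
  | true, false, true, true, true, false => Lk6_tftttf i
  | false, true, true, true, true, false => Lk6_fttttf i
  | true, true, true, true, true, false => Lk6_tttttf i
  | false, false, false, false, false, true => Lk6_ffffft i
  | true, false, false, false, false, true => Lk6_tfffft i
  | false, true, false, false, false, true => Lk6_ftffft i
  | true, true, false, false, false, true => Lk6_ttffft i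
  | false, false, true, false, false, true => Lk6_fftfft i
  | true, false, true, false, false, true => Lk6_tftfft i
  | false, true, true, false, false, true => Lk6_fttfft i
  | true, true, true, false, false, true => Lk6_tttfft i
  | false, false, false, true, false, true => Lk6_ffftft i
  | true, false, false, true, false, true => Lk6_tfftft i
  | false, true, false, true, false, true => Lk6_ftftft i
  | true, true, false, true, false, true => Lk6_ttftft i
  | false, false, true, true, false, true => Lk6_ffttft i
  | true, false, true, true, false, true => Lk6_tfttft i
  | false, true, true, true, false, true => Lk6_ftttft i
  | true, true, true, true, false, true => Lk6_ttttft i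
  | false, false, false, false, true, true => Lk6_fffftt i
  | true, false, false, false, true, true => Lk6_tffftt i
  | false, true, false, false, true, true => Lk6_ftfftt i
  | true, true, false, false, true, true => Lk6_ttfftt i
  | false, false, true, false, true, true => Lk6_fftftt i
  | true, false, true, false, true, true => Lk6_tftftt i
  | false, true, true, false, true, true => Lk6_fttftt i
  | true, true, true, false, true, true => Lk6_tttftt i
  | false, false, false, true, true, true => Lk6_fffttt i
  | true, false, false, true, true, true => Lk6_tffttt i
  | false, true, false, true, true, true => Lk6_ftfttt i
  | true, true, false, true, true, true => Lk6_ttfttt i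
  | false, false, true, true, true, true => Lk6_fftttt i
  | true, false, true, true, true, true => Lk6_tftttt i
  | false, true, true, true, true, true => Lk6_fttttt i
  | true, true, true, true, true, true => Lk6_tttttt i


end Six

end Deg5

end Summit.Ventures.PercRepro2
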